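import Summits.ResolutionOfSingularities.ResolutionOfSingularities.Theorems.RadicialJungCleanModelsSufficeChartsMonoid
import Mathlib.RingTheory.IntegralClosure.IsIntegralClosure.Basic
import Mathlib.Algebra.CharP.Reduced
import Mathlib.Algebra.CharP.Lemmas
import Mathlib.FieldTheory.Finite.Basic

/-!
# Route `RadicialJung`, crux `CleanModelsSuffice`, line `Sketch`: the Kummer chart, ring level

Helper for the registered stub `stub_charts` of the skeleton of
`Summit.ResolutionOfSingularities.ResolutionOfSingularities.Theses.RadicialJung.CleanModelsSuffice`
(stmt-ResolutionOfSingularities-15883). For `y ∈ L` with `y^p = ∏ u_i^{a_i}` (`u_i = t_i ∈ A`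
the boundary parameters of a toroidal point, `a₀ = 1`) the **Kummer chart** is the monoid
homomorphism `P_a → (L, ·)`, `c ↦ y^{c₀} ∏_{i≠0} u_i^{c_i}` on the Kummer monoid
`P_a` of `RadicialJungCleanModelsSufficeChartsMonoid.lean`. Everything about it is read off from
ONE identity: the `p`-th power of the value at `c` is the genuine monomial `∏ u_i^{w_i(c)}` of
the (nonnegative) weights. Consequences proved here: the values are integral over `A`
(`kummerChartIntegral : P_a → integralClosure A L`); they lie in the Kummer order
`A[z_0, …, z_{p-1}]`, `z_j = y^j/∏ t_i^{⌊j a_i/p⌋}` (`kummerChartAdjoin`, by comparing `p`-th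
powers in the field `L` of characteristic `p`, where `x ↦ x^p` is injective); and two elements of
`integralClosure A L` whose `p`-th powers differ by a unit of `A` are associated
(`associated_of_pow_eq_unit_mul_pow`), which is how the charts at two points will be compared.
-/

set_option linter.dupNamespace false -- mandated namespace of this single-conjunct summit

namespace Summit.ResolutionOfSingularities.ResolutionOfSingularities.Theorems.RadicialJung.CleanModelsSuffice

/-! ## Laurent monomials `∏ u_i^{e_i}` in a field -/

section ZMonomial

variable {L : Type*} [Field L] {n : ℕ}

/-- The Laurent monomial `∏ i, u_i ^ e_i` (`e_i ∈ ℤ`) in elements `u_i` of a field.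
[folklore] -/
def zmonomial (u : Fin n → L) (e : Fin n → ℤ) : L :=
  ∏ i, u i ^ e i

/-- `∏ u_i^0 = 1`. [folklore] -/
theorem zmonomial_zero (u : Fin n → L) : zmonomial u 0 = 1 := by
  simp [zmonomial]

/-- Monomials are multiplicative in the exponent (for nonzero `u_i`). [folklore] -/
theorem zmonomial_add (u : Fin n → L) (hu : ∀ i, u i ≠ 0) (e e' : Fin n → ℤ) :
    zmonomial u (e + e') = zmonomial u e * zmonomial u e' := by
  simp only [zmonomial, Pi.add_apply, zpow_add₀ (hu _), Finset.prod_mul_distrib]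

/-- `∏ u_i^{k e_i} = (∏ u_i^{e_i})^k`. [folklore] -/
theorem zmonomial_zsmul (u : Fin n → L) (k : ℤ) (e : Fin n → ℤ) :
    zmonomial u (k • e) = zmonomial u e ^ k := by
  simp only [zmonomial, Pi.smul_apply, smul_eq_mul, ← Finset.prod_zpow]
  refine Finset.prod_congr rfl fun i _ => ?_
  rw [mul_comm, zpow_mul]

/-- Monomials with natural exponents. [folklore] -/
theorem zmonomial_natCast (u : Fin n → L) (e : Fin n → ℕ) :
    zmonomial u (fun i => (e i : ℤ)) = ∏ i, u i ^ e i := by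
  simp [zmonomial]

/-- `(y^k ∏ u_i^{e_i})^p = ∏ u_i^{k a_i + p e_i}` when `y^p = ∏ u_i^{a_i}`. [folklore] -/
theorem ypow_mul_zmonomial_pow (p : ℕ) (a : Fin n → ℕ) (y : L) (u : Fin n → L)
    (hu : ∀ i, u i ≠ 0) (hyp : y ^ p = ∏ i, u i ^ a i) (k : ℤ) (e : Fin n → ℤ) :
    (y ^ k * zmonomial u e) ^ p =
      zmonomial u (k • (fun i => (a i : ℤ)) + (p : ℤ) • e) := by
  rw [zmonomial_add u hu, zmonomial_zsmul, zmonomial_zsmul, zmonomial_natCast, ← hyp, mul_pow,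
    ← zpow_natCast (y ^ k) p, ← zpow_mul, mul_comm k, zpow_mul, zpow_natCast, zpow_natCast]

end ZMonomial

/-! ## The Kummer chart `c ↦ y^{c₀} ∏_{i≠0} u_i^{c_i}` -/

section Chart

variable {L : Type*} [Field L] (p : ℕ) {m : ℕ} (a : Fin (m + 1) → ℕ) (y : L)
  (u : Fin (m + 1) → L)

/-- The value `y^{c₀} · ∏_{i ≠ 0} u_i^{c_i}` of the Kummer chart at the exponent vector `c`.
[folklore] -/
def kummerChartFun (c : Fin (m + 1) → ℤ) : L :=
  y ^ (c 0) * ∏ i ∈ Finset.univ.erase 0, u i ^ (c i)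

/-- The chart value as `y^{c₀}` times the Laurent monomial of `c` with its `0`-th entry removed.
[folklore] -/
theorem kummerChartFun_eq (c : Fin (m + 1) → ℤ) :
    kummerChartFun y u c = y ^ (c 0) * zmonomial u (Function.update c 0 0) := by
  rw [kummerChartFun, zmonomial, ← Finset.prod_erase (Finset.univ) (a := (0 : Fin (m + 1)))]
  · congr 1
    refine Finset.prod_congr rfl fun i hi => ?_
    rw [Function.update_of_ne (Finset.ne_of_mem_erase hi)]
  · simp

/-- The weights as a vector: `w(c) = c₀ · a + p · (c with c₀ := 0)`. [folklore] -/
theorem kummerWeight_eq (c : Fin (m + 1) → ℤ) :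
    kummerWeight p a c = c 0 • (fun i => (a i : ℤ)) + (p : ℤ) • Function.update c 0 0 := by
  funext i
  simp only [kummerWeight, Pi.add_apply, Pi.smul_apply, smul_eq_mul]
  by_cases hi : i = 0
  · subst hi; simp [mul_comm]
  · rw [Function.update_of_ne hi, if_neg hi, mul_comm (c 0)]

/-- **The `p`-th power of a chart value is the monomial of its weights**:
`(y^{c₀} ∏_{i≠0} u_i^{c_i})^p = ∏_i u_i^{w_i(c)}`. [folklore] -/
theorem kummerChartFun_pow (hu : ∀ i, u i ≠ 0) (hyp : y ^ p = ∏ i, u i ^ a i)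
    (c : Fin (m + 1) → ℤ) :
    kummerChartFun y u c ^ p = zmonomial u (kummerWeight p a c) := by
  rw [kummerChartFun_eq, ypow_mul_zmonomial_pow p a y u hu hyp, kummerWeight_eq]

/-- On the Kummer monoid the `p`-th power of a chart value is a genuine monomial
`∏ u_i^{w_i(c)}`, `w_i(c) ≥ 0`. [folklore] -/
theorem kummerChartFun_pow_of_mem (hu : ∀ i, u i ≠ 0) (hyp : y ^ p = ∏ i, u i ^ a i)
    {c : Fin (m + 1) → ℤ} (hc : c ∈ kummerMonoid p a) :
    kummerChartFun y u c ^ p = ∏ i, u i ^ (kummerWeight p a c i).toNat := by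
  rw [kummerChartFun_pow p a y u hu hyp c, ← zmonomial_natCast]
  congr 1
  funext i
  rw [Int.toNat_of_nonneg (kummerWeight_nonneg p a hc i)]

/-- `Φ(0) = 1`. [folklore] -/
theorem kummerChartFun_zero : kummerChartFun y u 0 = 1 := by
  simp [kummerChartFun]

/-- `Φ(c + c') = Φ(c) Φ(c')` (for `y` and the `u_i` nonzero). [folklore] -/
theorem kummerChartFun_add (hy : y ≠ 0) (hu : ∀ i, u i ≠ 0) (c c' : Fin (m + 1) → ℤ) :
    kummerChartFun y u (c + c') = kummerChartFun y u c * kummerChartFun y u c' := by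
  simp only [kummerChartFun, Pi.add_apply, zpow_add₀ hy, zpow_add₀ (hu _), Finset.prod_mul_distrib]
  ring

/-- **The Kummer chart** `P_a → (L, ·)`, `c ↦ y^{c₀} ∏_{i≠0} u_i^{c_i}`, as a monoid homomorphism.
[folklore] -/
def kummerChart (hy : y ≠ 0) (hu : ∀ i, u i ≠ 0) : Multiplicative (kummerMonoid p a) →* L where
  toFun c := kummerChartFun y u ((Multiplicative.toAdd c : kummerMonoid p a) : Fin (m + 1) → ℤ)
  map_one' := by
    change kummerChartFun y u ((0 : kummerMonoid p a) : Fin (m + 1) → ℤ) = 1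
    rw [AddSubmonoid.coe_zero, kummerChartFun_zero]
  map_mul' c c' := by
    change kummerChartFun y u ((Multiplicative.toAdd c + Multiplicative.toAdd c' : kummerMonoid p a) :
      Fin (m + 1) → ℤ) = _
    rw [AddSubmonoid.coe_add, kummerChartFun_add y u hy hu]

/-- The values of the Kummer chart. [folklore] -/
theorem kummerChart_ofAdd (hy : y ≠ 0) (hu : ∀ i, u i ≠ 0) (c : kummerMonoid p a) :
    kummerChart p a y u hy hu (Multiplicative.ofAdd c) =
      y ^ ((c : Fin (m + 1) → ℤ) 0) * ∏ i ∈ Finset.univ.erase 0, u i ^ ((c : Fin (m + 1) → ℤ) i) :=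
  rfl

/-- The values of the Kummer chart, as `kummerChartFun`. [folklore] -/
theorem kummerChart_apply (hy : y ≠ 0) (hu : ∀ i, u i ≠ 0)
    (c : Multiplicative (kummerMonoid p a)) :
    kummerChart p a y u hy hu c =
      kummerChartFun y u ((Multiplicative.toAdd c : kummerMonoid p a) : Fin (m + 1) → ℤ) :=
  rfl

end Chart

/-! ## Charts through an `A`-algebra: integrality and the Kummer order -/

section Algebra

variable {A L : Type*} [CommRing A] [Field L] [Algebra A L] (p : ℕ) {m : ℕ}
  (a : Fin (m + 1) → ℕ) (y : L) (t : Fin (m + 1) → A)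

/-- With `u_i = t_i ∈ A`: `Φ(c)^p = ∏ t_i^{w_i(c)} ∈ A` on the Kummer monoid. [folklore] -/
theorem kummerChartFun_pow_eq_algebraMap (ht : ∀ i, algebraMap A L (t i) ≠ 0)
    (hyp : y ^ p = algebraMap A L (∏ i, t i ^ a i)) {c : Fin (m + 1) → ℤ}
    (hc : c ∈ kummerMonoid p a) :
    kummerChartFun y (fun i => algebraMap A L (t i)) c ^ p =
      algebraMap A L (∏ i, t i ^ (kummerWeight p a c i).toNat) := by
  rw [kummerChartFun_pow_of_mem p a y _ ht (by rw [hyp, map_prod]; simp) hc, map_prod]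
  simp

/-- The chart values are integral over `A` (their `p`-th powers lie in `A`). [folklore] -/
theorem isIntegral_kummerChartFun (hp : 0 < p) (ht : ∀ i, algebraMap A L (t i) ≠ 0)
    (hyp : y ^ p = algebraMap A L (∏ i, t i ^ a i)) {c : Fin (m + 1) → ℤ}
    (hc : c ∈ kummerMonoid p a) :
    IsIntegral A (kummerChartFun y (fun i => algebraMap A L (t i)) c) := by
  refine IsIntegral.of_pow hp ?_
  rw [kummerChartFun_pow_eq_algebraMap p a y t ht hyp hc]
  exact isIntegral_algebraMap

/-- **The Kummer chart into the integral closure** `P_a → integralClosure A L`.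
[folklore] -/
def kummerChartIntegral (hp : 0 < p) (hy : y ≠ 0) (ht : ∀ i, algebraMap A L (t i) ≠ 0)
    (hyp : y ^ p = algebraMap A L (∏ i, t i ^ a i)) :
    Multiplicative (kummerMonoid p a) →* integralClosure A L :=
  (kummerChart p a y (fun i => algebraMap A L (t i)) hy ht).codRestrict (integralClosure A L)
    fun c => isIntegral_kummerChartFun p a y t hp ht hyp (Multiplicative.toAdd c).2

/-- The values of `kummerChartIntegral` in `L`. [folklore] -/
theorem coe_kummerChartIntegral (hp : 0 < p) (hy : y ≠ 0) (ht : ∀ i, algebraMap A L (t i) ≠ 0)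
    (hyp : y ^ p = algebraMap A L (∏ i, t i ^ a i)) (c : Multiplicative (kummerMonoid p a)) :
    (kummerChartIntegral p a y t hp hy ht hyp c : L) =
      kummerChart p a y (fun i => algebraMap A L (t i)) hy ht c :=
  rfl

/-- **The chart values lie in the Kummer order** `A[z_0, …, z_{p-1}]`,
`z_j = y^j / ∏ t_i^{⌊j a_i/p⌋}`: for `c ∈ P_a` with `c₀ ≡ j (mod p)`, `0 ≤ j < p`,
`Φ(c) = z_j · ∏ t_i^{⌊w_i(c)/p⌋}` (compare `p`-th powers in the perfect-power-injective field `L`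
of characteristic `p`: `w_i(c) ≡ j a_i (mod p)`). [folklore] -/
theorem kummerChartFun_eq_z_mul [CharP L p] (hp : p.Prime) (ht : ∀ i, algebraMap A L (t i) ≠ 0)
    (hyp : y ^ p = algebraMap A L (∏ i, t i ^ a i)) (z : Fin p → L)
    (hz : ∀ j, z j = y ^ (j : ℕ) / algebraMap A L (∏ i, t i ^ ((j : ℕ) * a i / p)))
    {c : Fin (m + 1) → ℤ} (hc : c ∈ kummerMonoid p a) (j : ℕ) (hjp : j < p)
    (hj : (j : ℤ) = c 0 % p) :
    kummerChartFun y (fun i => algebraMap A L (t i)) c =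
      z ⟨j, hjp⟩ * algebraMap A L (∏ i, t i ^ ((kummerWeight p a c i).toNat / p)) := by
  haveI : ExpChar L p := ExpChar.prime hp
  set u : Fin (m + 1) → L := fun i => algebraMap A L (t i) with hu_def
  have hu : ∀ i, u i ≠ 0 := ht
  have hyp' : y ^ p = ∏ i, u i ^ a i := by rw [hyp, map_prod]; simp [hu_def]
  have hmon : ∀ e : Fin (m + 1) → ℕ,
      algebraMap A L (∏ i, t i ^ e i) = zmonomial u (fun i => (e i : ℤ)) := by
    intro e; rw [zmonomial_natCast, map_prod]; simp [hu_def]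
  -- the exponent identity `j a_i + p (⌊w_i/p⌋ - ⌊j a_i/p⌋) = w_i`
  have hexp : ∀ i, (j : ℤ) * a i +
      (p : ℤ) * ((((kummerWeight p a c i).toNat / p : ℕ) : ℤ) - ((j * a i / p : ℕ) : ℤ)) =
        kummerWeight p a c i := by
    intro i
    set w := kummerWeight p a c i with hw
    have hw0 : 0 ≤ w := kummerWeight_nonneg p a hc i
    have h3 : ((w.toNat : ℕ) : ℤ) = w := Int.toNat_of_nonneg hw0
    have h1 : w ≡ (a i : ℤ) * c 0 [ZMOD p] := kummerWeight_modEq p a c i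
    have h2 : (a i : ℤ) * c 0 ≡ (a i : ℤ) * j [ZMOD p] := by
      rw [hj]; exact Int.ModEq.mul_left _ (Int.mod_modEq _ _).symm
    have h4 : (w.toNat % p : ℕ) = (j * a i % p : ℕ) := by
      have h5 : ((w.toNat : ℕ) : ℤ) % p = ((j * a i : ℕ) : ℤ) % p := by
        rw [h3]; push_cast; rw [mul_comm (j : ℤ)]; exact h1.trans h2
      have h5' : ((w.toNat % p : ℕ) : ℤ) = ((j * a i % p : ℕ) : ℤ) := by push_cast; exact h5
      exact_mod_cast h5'
    have h6 : (p : ℤ) * ((w.toNat / p : ℕ) : ℤ) + ((w.toNat % p : ℕ) : ℤ) = w := by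
      rw [← h3]; exact_mod_cast Nat.div_add_mod w.toNat p
    have h7 : (p : ℤ) * ((j * a i / p : ℕ) : ℤ) + ((j * a i % p : ℕ) : ℤ) = (j : ℤ) * a i := by
      exact_mod_cast Nat.div_add_mod (j * a i) p
    rw [h4] at h6
    linarith
  -- the right-hand side as `y^j` times a Laurent monomial
  have hbase : y ^ (j : ℕ) / algebraMap A L (∏ i, t i ^ (j * a i / p)) *
      algebraMap A L (∏ i, t i ^ ((kummerWeight p a c i).toNat / p)) =
      y ^ (j : ℤ) * zmonomial u
        (fun i => (((kummerWeight p a c i).toNat / p : ℕ) : ℤ) - ((j * a i / p : ℕ) : ℤ)) := by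
    rw [hmon (fun i => j * a i / p), hmon (fun i => (kummerWeight p a c i).toNat / p),
      ← zpow_natCast y j]
    have hsplit : (fun i => (((kummerWeight p a c i).toNat / p : ℕ) : ℤ) - ((j * a i / p : ℕ) : ℤ)) =
        (fun i => (((kummerWeight p a c i).toNat / p : ℕ) : ℤ)) +
          (-1 : ℤ) • (fun i => ((j * a i / p : ℕ) : ℤ)) := by
      funext i; simp [sub_eq_add_neg]
    rw [hsplit, zmonomial_add u hu, zmonomial_zsmul, zpow_neg, zpow_one, div_eq_mul_inv]
    ring
  apply frobenius_inj L p
  rw [frobenius_def, frobenius_def, kummerChartFun_pow p a y u hu hyp' c, hz]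
  rw [hbase, ypow_mul_zmonomial_pow p a y u hu hyp']
  congr 1
  funext i
  simp only [Pi.add_apply, Pi.smul_apply, smul_eq_mul]
  linarith [hexp i]

/-- The chart values lie in the Kummer order `A[z_j]`. [folklore] -/
theorem kummerChartFun_mem_adjoin [CharP L p] (hp : p.Prime)
    (ht : ∀ i, algebraMap A L (t i) ≠ 0) (hyp : y ^ p = algebraMap A L (∏ i, t i ^ a i))
    (z : Fin p → L) (hz : ∀ j, z j = y ^ (j : ℕ) / algebraMap A L (∏ i, t i ^ ((j : ℕ) * a i / p)))
    {c : Fin (m + 1) → ℤ} (hc : c ∈ kummerMonoid p a) :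
    kummerChartFun y (fun i => algebraMap A L (t i)) c ∈ Algebra.adjoin A (Set.range z) := by
  have hp0 : (0 : ℤ) < p := by exact_mod_cast hp.pos
  have hlt : (c 0 % p).toNat < p := by
    have h := Int.emod_lt_of_pos (c 0) hp0
    have h0 := Int.emod_nonneg (c 0) hp0.ne'
    omega
  rw [kummerChartFun_eq_z_mul p a y t hp ht hyp z hz hc (c 0 % p).toNat hlt
    (Int.toNat_of_nonneg (Int.emod_nonneg (c 0) hp0.ne'))]
  exact Subalgebra.mul_mem _ (Algebra.subset_adjoin (Set.mem_range_self _))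
    (Subalgebra.algebraMap_mem _ _)

/-- **The Kummer chart into the Kummer order** `P_a → A[z_0, …, z_{p-1}]`. [folklore] -/
def kummerChartAdjoin [CharP L p] (hp : p.Prime) (hy : y ≠ 0)
    (ht : ∀ i, algebraMap A L (t i) ≠ 0) (hyp : y ^ p = algebraMap A L (∏ i, t i ^ a i))
    (z : Fin p → L) (hz : ∀ j, z j = y ^ (j : ℕ) / algebraMap A L (∏ i, t i ^ ((j : ℕ) * a i / p))) :
    Multiplicative (kummerMonoid p a) →* Algebra.adjoin A (Set.range z) :=
  (kummerChart p a y (fun i => algebraMap A L (t i)) hy ht).codRestrict _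
    fun c => kummerChartFun_mem_adjoin p a y t hp ht hyp z hz (Multiplicative.toAdd c).2

/-- The values of `kummerChartAdjoin` in `L`. [folklore] -/
theorem coe_kummerChartAdjoin [CharP L p] (hp : p.Prime) (hy : y ≠ 0)
    (ht : ∀ i, algebraMap A L (t i) ≠ 0) (hyp : y ^ p = algebraMap A L (∏ i, t i ^ a i))
    (z : Fin p → L) (hz : ∀ j, z j = y ^ (j : ℕ) / algebraMap A L (∏ i, t i ^ ((j : ℕ) * a i / p)))
    (c : Multiplicative (kummerMonoid p a)) :
    (kummerChartAdjoin p a y t hp hy ht hyp z hz c : L) =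
      kummerChart p a y (fun i => algebraMap A L (t i)) hy ht c :=
  rfl

end Algebra

/-! ## Associatedness in the integral closure from `p`-th powers -/

section Associated

/-- **Two elements of `integralClosure A L` whose `p`-th powers differ by a unit of `A` are
associated**: `f^p = u g^p`, `u ∈ A^×` ⇒ `f = ε g` with `ε^{±1}` integral (roots of
`X^p - u^{±1}`). [folklore] -/
theorem associated_of_pow_eq_unit_mul_pow {A L : Type*} [CommRing A] [Field L] [Algebra A L]
    (p : ℕ) (hp : 0 < p) (f g : integralClosure A L) (u : A) (hu : IsUnit u)
    (h : (f : L) ^ p = algebraMap A L u * (g : L) ^ p) : Associated f g := by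
  have hu' : IsUnit (algebraMap A L u) := hu.map _
  by_cases hg : (g : L) = 0
  · have hf : (f : L) = 0 := by
      rw [hg, zero_pow hp.ne', mul_zero] at h
      exact pow_eq_zero_iff hp.ne' |>.mp h
    have hf' : f = 0 := Subtype.ext hf
    have hg' : g = 0 := Subtype.ext hg
    rw [hf', hg']
  · set ε : L := (f : L) / g with hε
    have hεp : ε ^ p = algebraMap A L u := by
      rw [hε, div_pow, h, mul_div_assoc, div_self (pow_ne_zero _ hg), mul_one]
    have hε0 : ε ≠ 0 := fun h0 => by
      rw [h0, zero_pow hp.ne'] at hεp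
      exact hu'.ne_zero hεp.symm
    have hεint : IsIntegral A ε := IsIntegral.of_pow hp (by rw [hεp]; exact isIntegral_algebraMap)
    have hεinv : IsIntegral A ε⁻¹ := by
      refine IsIntegral.of_pow hp ?_
      rw [inv_pow, hεp]
      obtain ⟨v, rfl⟩ := hu
      rw [← map_units_inv]
      exact isIntegral_algebraMap
    let ε' : (integralClosure A L)ˣ :=
      ⟨⟨ε, hεint⟩, ⟨ε⁻¹, hεinv⟩, Subtype.ext (mul_inv_cancel₀ hε0), Subtype.ext (inv_mul_cancel₀ hε0)⟩
    refine Associated.symm ⟨ε', Subtype.ext ?_⟩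
    change (g : L) * ε = f
    rw [hε, mul_div_cancel₀ _ hg]

/-- **Unit criterion**: an element of `integralClosure A L` whose `p`-th power is a unit of `A`
is a unit. [folklore] -/
theorem isUnit_of_pow_eq_algebraMap {A L : Type*} [CommRing A] [Field L] [Algebra A L]
    (p : ℕ) (hp : 0 < p) (f : integralClosure A L) (u : A)
    (hu : IsUnit u) (h : (f : L) ^ p = algebraMap A L u) : IsUnit f := by
  have h1 : Associated f 1 :=
    associated_of_pow_eq_unit_mul_pow p hp f 1 u hu (by simpa using h)
  exact (associated_one_iff_isUnit).mp h1

end Associated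


end Summit.ResolutionOfSingularities.ResolutionOfSingularities.Theorems.RadicialJung.CleanModelsSuffice
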